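import Summits.BirchSwinnertonDyer.BirchSwinnertonDyer.Theorems.SchneiderFreeAdditiveX3GordCellThreeOfPrintLattice
import Literature.NumberTheory.GaloisRepresentations.DecompositionFieldRigidity
import Literature.NumberTheory.EllipticCurves.PAdicGrossZagierConstantTermProofs
import Literature.NumberTheory.DiophantineGeometry.TateAlgorithmOrdDiscriminant
import HarnessLib

/-!
# Route `SchneiderFreeAdditiveX3` (K1 door): at a prime SPLIT in the Heegner field the decomposition groups fix `√d_K`; hence under
# the non-anomalous clause `hna` the curve has no `K`-rational `p`-torsion — Keller–Yin's `H⁰(K, ρ̄_{f̃} ⊗ ε) = 0` is AUTOMATIC, and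
# the per-datum (G-ord) door at `p = 3` ∧ NAT carries NO per-curve hypothesis beyond the cell predicates

Cell `bsd-schneider-ideate`, seat `bsd-schneider-door-c5` (prover, generation 26; assembly layer; `--supports` 19177).
PARTITION: board row B6 ∩ X3 ∩ sst-twist, `r = 1`, (G-ord, `e = 2`) half at `p = 3` (686 NAT pairs) — bookkeeping on top of
`…GordCellThreeOfPrintLattice` (p681419); types-the-object-of nothing; closes none of B6's cells (BSD NOT advanced).  bears_on: K1-door (19177).

WHAT.
* §1 `exists_sq_eq_algebraMap_discr_of_split` — for a quadratic field `K` and an odd prime `p` SPLIT in `K`, `d_K` is a square in `ℚ_v`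
  (`v ∋ p`): `d_K ≡ b² (mod p)`, `p ∤ b` (tree `isSquare_discr_of_ncard_primesOver_eq_two`), so `d_K/b²` is a principal unit, hence a square
  by Hensel (tree `exists_pow_eq_of_norm_sub_one_lt`).
* §2 **`smul_geomSqrt_discr_eq_of_mem_decompositionSubgroup`** — every `σ` in a decomposition group `D_𝔓 ≤ Γ_ℚ`, `𝔓 ∣ p`, FIXES `√d_K`:
  the `v`-adic square root is algebraic, so it comes from the decomposition field `Z₀ = ι⁻¹(ℚ_v)` (tree
  `exists_eq_absClosureEmbedding_of_pow_eq`), which `D_{𝔓₀} = res(Γ_{ℚ_v})` fixes (tree `absGaloisRestrict_smul_eq_of_mem_range`,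
  `decompositionSubgroup_adicCompletionPrime_eq_range`); `±√d_K` and conjugation `𝔓 = τ𝔓₀` finish.  (Neukirch, ANT II (9.6): the
  decomposition group of a split prime is trivial on `K`.)
* §3 `addOrderOf_ne_twist_of_hna` — no rational point of order `p` on the twist `W^{(d_K)}` under `hna` (door-c4 g7's `addOrderOf_ne_twist`
  with the uniqueness of the line replaced by `hna`: the sign-isotypic line `ℤQ₁` is rational and, by §2, FIXED POINTWISE by `D_𝔓`).
* §4 **`forall_baseChange_nsmul_eq_zero_of_hna`** — `W(K)[p] = 0` under `hna` for `p` split in the quadratic field `K` (odd-part quadratic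
  descent `#W(K)[p^∞] = #W(ℚ)[p^∞]·#W^{(d_K)}(ℚ)[p^∞]`, door-c4 g7's pattern, with `KYBranchThreeLattice.addOrderOf_ne_of_hna` and §3).
* §5 **`additiveIMCLowerBDPOnTree_subGordTwo_three_offSliver`** — the per-datum (G-ord, `e = 2`) LOWER socket AT `p = 3`, off the
  `d_K = −3` sliver, for EVERY globally minimal `W` of the cell with non-anomalous twists (no `hlat`, no `htf`): ⟸ Kolyvagin ∧ modularity
  ∧ Hsieh A ∧ LZZ ∧ Castella–Hsieh signed ∧ [DIV.dvd] ∧ [AN3] ∧ [BR3] ∧ eleven published facts ∧ the comparison data `hAUX`.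

HONEST FRAMING: theorems only; §1–§4 unconditional arithmetic / Galois bookkeeping over tree theorems; §5 a composition CONDITIONAL on the
displayed named statements ([DIV.dvd], [AN3] claim-tagged preprint sentences — [AN3] PUB-composed at `p = 3` per memo FINDING-door-c5-g26 §2,
audit pending; [BR3] and eleven facts published, typed) and on the existence statement `hAUX`; nothing closed; BSD proved for no curve;
«closes rung: none».  References: Neukirch ANT II §4 (4.6), §9 (9.6) [NeukirchANT1999]; Silverman AEC X.5.4, Ex. 10.16 [SilvermanAEC2009];
Mazur 1977 III §5 [Mazur1977]; Keller–Yin arXiv:2410.23241 §3.1 (`H⁰(K, ρ̄_{f̃} ⊗ ε) = 0`) [KellerYin2024b].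
-/

set_option autoImplicit false
-- `Summit.<P>.<Sub>` repeats `BirchSwinnertonDyer` by the tree's layout convention (D-0017)
set_option linter.dupNamespace false

noncomputable section

open scoped Classical NumberField Pointwise

open Field NumberField IsDedekindDomain WeierstrassCurve PowerSeries Rat.HeightOneSpectrum
  Literature.NumberTheory.EllipticCurves Literature.NumberTheory.EllipticCurves.GreenbergSelmer
  Literature.NumberTheory.GaloisRepresentations Literature.NumberTheory.GaloisCohomology
  Literature.NumberTheory.EllipticCurves.ModularForms Literature.NumberTheory.EllipticCurves.Rank1Residual
  Literature.NumberTheory.EllipticCurves.KellerYin2024 Literature.NumberTheory.EllipticCurves.CaiShuTian2014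
  Literature.NumberTheory.QuadraticFields
  Literature.NumberTheory.IwasawaTheory Literature.NumberTheory.IwasawaTheory.Greenberg2016
  Literature.NumberTheory.IwasawaTheory.Greenberg2006
  Summit.BirchSwinnertonDyer.Rank1Residual Summit.BirchSwinnertonDyer.Rank1Residual.X11b
  Summit.BirchSwinnertonDyer.Rank1Residual.X11b.AcSelmer Summit.BirchSwinnertonDyer.Rank1Residual.X11b.Halves
  Summit.BirchSwinnertonDyer.Rank1Residual.X11b.CongruenceLimit
  Summit.BirchSwinnertonDyer.Rank1Residual.Additive
  Summit.BirchSwinnertonDyer.BirchSwinnertonDyer.Theorems.SchneiderFree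
  Summit.BirchSwinnertonDyer.BirchSwinnertonDyer.Theorems.SchneiderFree.KYRead
  Summit.BirchSwinnertonDyer.BirchSwinnertonDyer.Theorems.SchneiderFree.GoodMember
  Summit.BirchSwinnertonDyer.BirchSwinnertonDyer.Theses.SchneiderFreeAdditiveX3
  Summit.BirchSwinnertonDyer.BirchSwinnertonDyer.Theorems.SchneiderFreeAdditiveX3.LZZMatch
  Summit.BirchSwinnertonDyer.BirchSwinnertonDyer.Theorems.SchneiderFreeAdditiveX3.ControlDischarged
  Summit.BirchSwinnertonDyer.BirchSwinnertonDyer.Theorems.SchneiderFreeAdditiveX3.KYBranchOnly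
  Summit.BirchSwinnertonDyer.BirchSwinnertonDyer.Theorems.SchneiderFreeAdditiveX3.KYBranchThree
  Summit.BirchSwinnertonDyer.BirchSwinnertonDyer.Theorems.SchneiderFreeAdditiveX3.KYBranchThreeDoor
  Summit.BirchSwinnertonDyer.BirchSwinnertonDyer.Theorems.SchneiderFreeAdditiveX3.KYBranchThreeLattice
  Summit.BirchSwinnertonDyer.BirchSwinnertonDyer.Theorems.SchneiderFreeAdditiveX3.KYNonAnomalousTwist
open Literature.NumberTheory.EllipticCurves.CastellaGrossiLeeSkinner2022
  (cor126_residualCharacter_globalLift cor126_residualCharacter_localSurjective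
    prop125_characterGrSelmerDual_torsion_muZero_dim prop14_residualCharacterSelmer_finite IsKatzLFunction)

namespace Summit.BirchSwinnertonDyer.BirchSwinnertonDyer.Theorems.SchneiderFreeAdditiveX3.KYBranchThreeTorsion

/-! ### §1 At a split prime, `d_K` is a square in `ℚ_v` -/

/-- **`d_K` is a square in `ℚ_v` for `v ∋ p`, `p` an odd prime SPLIT in the quadratic field `K`.**  `d_K ≡ b² (mod p)` with `p ∤ b` (tree
`isSquare_discr_of_ncard_primesOver_eq_two`), so `y = d_K/b²` has `‖y − 1‖_v < 1`, and Hensel (`exists_pow_eq_of_norm_sub_one_lt`, `2 ∈ 𝒪_vˣ`)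
makes `y`, hence `d_K`, a square. [cite: NeukirchANT1999, Ch. II §4 Lemma (4.6)] -/
theorem exists_sq_eq_algebraMap_discr_of_split (K : Type) [Field K] [NumberField K] (h2K : Module.finrank ℚ K = 2)
    {p : ℕ} [hp : Fact p.Prime] (hp2 : p ≠ 2) (hsplit : ((Ideal.span {(p : ℤ)}).primesOver (𝓞 K)).ncard = 2)
    {v : HeightOneSpectrum (𝓞 ℚ)} (hpv : ((p : ℕ) : 𝓞 ℚ) ∈ v.asIdeal) :
    ∃ s : v.adicCompletion ℚ, s ^ 2 = algebraMap ℚ (v.adicCompletion ℚ) (NumberField.discr K : ℚ) := by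
  have hpP : p.Prime := hp.out
  have hirr : Irreducible (p : ℤ) := (Nat.prime_iff_prime_int.mp hpP).irreducible
  -- `v ∩ ℤ = pℤ`: an integer prime to `p` is not in `v`
  have hnotmem : ∀ n : ℤ, ¬ (p : ℤ) ∣ n → ((n : ℤ) : 𝓞 ℚ) ∉ v.asIdeal := by
    intro n hn hnv
    obtain ⟨x, y, hxy⟩ := (Irreducible.coprime_iff_not_dvd hirr).mpr hn
    apply v.isPrime.ne_top
    rw [Ideal.eq_top_iff_one]
    have h1 : ((1 : ℤ) : 𝓞 ℚ) = (x : 𝓞 ℚ) * ((p : ℕ) : 𝓞 ℚ) + (y : 𝓞 ℚ) * ((n : ℤ) : 𝓞 ℚ) := by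
      rw [← hxy]; push_cast; ring
    rw [Int.cast_one] at h1
    rw [h1]
    exact v.asIdeal.add_mem (v.asIdeal.mul_mem_left _ hpv) (v.asIdeal.mul_mem_left _ hnv)
  obtain ⟨⟨β, hβ⟩, hne⟩ := isSquare_discr_of_ncard_primesOver_eq_two h2K hpP hsplit
  -- an integer lift `b` of `β`
  set b : ℤ := (β.val : ℤ) with hb
  have hbβ : (b : ZMod p) = β := by rw [hb, Int.cast_natCast, ZMod.natCast_zmod_val]
  have hdb : (p : ℤ) ∣ NumberField.discr K - b ^ 2 := by
    rw [← ZMod.intCast_zmod_eq_zero_iff_dvd, Int.cast_sub, Int.cast_pow, hbβ, hβ, sq, sub_self]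
  have hpb : ¬ (p : ℤ) ∣ b := by
    intro h
    apply hne
    rw [hβ, ← hbβ, (ZMod.intCast_zmod_eq_zero_iff_dvd b p).mpr h, mul_zero]
  have hb0 : (b : ℚ) ≠ 0 := by
    intro h
    exact hpb (by rw [show b = 0 by exact_mod_cast h]; exact dvd_zero _)
  -- norms in `ℚ_v`
  have hcast : ∀ n : ℤ, algebraMap ℚ (v.adicCompletion ℚ) (n : ℚ) =
      algebraMap (𝓞 ℚ) (v.adicCompletion ℚ) ((n : ℤ) : 𝓞 ℚ) := by
    intro n
    rw [IsScalarTower.algebraMap_apply (𝓞 ℚ) ℚ (v.adicCompletion ℚ), map_intCast, map_intCast, map_intCast]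
  have hlt : ‖algebraMap ℚ (v.adicCompletion ℚ) ((NumberField.discr K - b ^ 2 : ℤ) : ℚ)‖ < 1 := by
    rw [hcast, norm_algebraMap_ringOfIntegers_lt_one_iff ℚ v]
    obtain ⟨k, hk⟩ := hdb
    rw [hk, Int.cast_mul, Int.cast_natCast]
    exact v.asIdeal.mul_mem_right _ hpv
  have hbn : ‖algebraMap ℚ (v.adicCompletion ℚ) (b : ℚ)‖ = 1 := by
    refine le_antisymm (by rw [hcast]; exact norm_algebraMap_ringOfIntegers_le_one ℚ v _) ?_
    by_contra hlt1
    rw [not_le, hcast, norm_algebraMap_ringOfIntegers_lt_one_iff ℚ v] at hlt1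
    exact hnotmem b hpb hlt1
  -- `y = d_K / b²` is a principal unit
  set y : v.adicCompletion ℚ := algebraMap ℚ (v.adicCompletion ℚ) ((NumberField.discr K : ℚ) / (b : ℚ) ^ 2) with hy
  have hb0' : algebraMap ℚ (v.adicCompletion ℚ) (b : ℚ) ≠ 0 := by
    rw [← norm_pos_iff, hbn]; exact one_pos
  have hy1 : ‖y - 1‖ < 1 := by
    have e1 : (NumberField.discr K : ℚ) / (b : ℚ) ^ 2 - 1 = ((NumberField.discr K - b ^ 2 : ℤ) : ℚ) / (b : ℚ) ^ 2 := by
      rw [div_sub_one (pow_ne_zero 2 hb0)]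
      push_cast
      ring
    have e : y - 1 = algebraMap ℚ (v.adicCompletion ℚ) ((NumberField.discr K - b ^ 2 : ℤ) : ℚ) /
        algebraMap ℚ (v.adicCompletion ℚ) (b : ℚ) ^ 2 := by
      rw [hy, ← map_one (algebraMap ℚ (v.adicCompletion ℚ)), ← map_sub, e1, map_div₀, map_pow]
    rw [e, norm_div, norm_pow, hbn, one_pow, div_one]
    exact hlt
  -- Hensel: `y = r²`
  have h2unit : IsUnit ((2 : ℕ) : v.adicCompletionIntegers ℚ) := by
    have h2 : ((2 : ℤ) : 𝓞 ℚ) ∉ v.asIdeal := hnotmem 2 (by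
      intro h
      have := Int.le_of_dvd (by norm_num) h
      have h2p : (p : ℤ) ≠ 2 := by exact_mod_cast hp2
      have hp1 : 2 ≤ (p : ℤ) := by exact_mod_cast hpP.two_le
      omega)
    have hu := IsDedekindDomain.HeightOneSpectrum.isUnit_algebraMap_adicCompletionIntegers ℚ v h2
    rwa [map_intCast, show ((2 : ℤ) : v.adicCompletionIntegers ℚ) = ((2 : ℕ) : v.adicCompletionIntegers ℚ) by norm_cast]
      at hu
  obtain ⟨r, hr⟩ := exists_pow_eq_of_norm_sub_one_lt ℚ v hy1 h2unit
  refine ⟨r * algebraMap ℚ (v.adicCompletion ℚ) (b : ℚ), ?_⟩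
  rw [mul_pow, hr, hy, ← map_pow, ← map_mul, div_mul_cancel₀ _ (pow_ne_zero 2 hb0)]


/-! ### §2 The decomposition groups at a split prime fix `√d_K` -/

/-- A square root of `d` in `ℚ̄` is `±√d`. [folklore] -/
theorem eq_geomSqrt_or_eq_neg_of_sq_eq {d : ℚ} {z : AlgebraicClosure ℚ}
    (hz : z ^ 2 = algebraMap ℚ (AlgebraicClosure ℚ) d) : z = geomSqrt d ∨ z = -geomSqrt d := by
  have h0 : (z - geomSqrt d) * (z + geomSqrt d) = 0 := by
    have : (z - geomSqrt d) * (z + geomSqrt d) = z ^ 2 - geomSqrt d ^ 2 := by ring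
    rw [this, hz, geomSqrt_sq]
    exact sub_self _
  rcases mul_eq_zero.mp h0 with h | h
  · exact Or.inl (sub_eq_zero.mp h)
  · exact Or.inr (eq_neg_of_add_eq_zero_left h)

/-- **At an odd prime `p` SPLIT in the quadratic field `K`, the decomposition group `D_{𝔓₀} ≤ Γ_ℚ` of the prime `𝔓₀ = adicCompletionPrime ℚ v`
above `v ∋ p` fixes `√d_K`.**  The `v`-adic square root of `d_K` (§1) is algebraic, hence the image of some `z ∈ ℚ̄` lying in the decomposition
field `Z₀ = ι⁻¹(ℚ_v)` (tree `exists_eq_absClosureEmbedding_of_pow_eq`); `Z₀` is fixed by `D_{𝔓₀} = res(Γ_{ℚ_v})` (tree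
`absGaloisRestrict_smul_eq_of_mem_range`, `decompositionSubgroup_adicCompletionPrime_eq_range`); and `z = ±√d_K`.  (Neukirch: the
decomposition group of a split prime acts trivially on `K`; the other primes above `v` are conjugate.) [cite: NeukirchANT1999, Ch. II §9 Prop. (9.6)] -/
theorem smul_geomSqrt_discr_eq_of_mem_decompositionSubgroup (K : Type) [Field K] [NumberField K] (h2K : Module.finrank ℚ K = 2)
    {p : ℕ} [hp : Fact p.Prime] (hp2 : p ≠ 2) (hsplit : ((Ideal.span {(p : ℤ)}).primesOver (𝓞 K)).ncard = 2)
    {v : HeightOneSpectrum (𝓞 ℚ)} (hpv : ((p : ℕ) : 𝓞 ℚ) ∈ v.asIdeal)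
    {g : absoluteGaloisGroup ℚ} (hg : g ∈ (adicCompletionPrime ℚ v).decompositionSubgroup (absoluteGaloisGroup ℚ)) :
    g • geomSqrt ((NumberField.discr K : ℤ) : ℚ) = geomSqrt ((NumberField.discr K : ℤ) : ℚ) := by
  set d : ℚ := ((NumberField.discr K : ℤ) : ℚ) with hd
  obtain ⟨s, hs⟩ := exists_sq_eq_algebraMap_discr_of_split K h2K hp2 hsplit hpv
  -- the `v`-adic square root comes from `z ∈ Z₀`, `z² = d`
  have hι : absClosureEmbedding ℚ (v.adicCompletion ℚ) (algebraMap ℚ (AlgebraicClosure ℚ) d) =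
      algebraMap ℚ (AlgebraicClosure (v.adicCompletion ℚ)) d :=
    (absClosureEmbedding ℚ (v.adicCompletion ℚ)).commutes d
  have h : algebraMap (v.adicCompletion ℚ) (AlgebraicClosure (v.adicCompletion ℚ)) s ^ 2 =
      absClosureEmbedding ℚ (v.adicCompletion ℚ) (algebraMap ℚ (AlgebraicClosure ℚ) d) := by
    rw [← map_pow, hs, hι, ← IsScalarTower.algebraMap_apply]
  obtain ⟨z, hzι, hz2⟩ := exists_eq_absClosureEmbedding_of_pow_eq ℚ v two_pos h
  have hz : z = geomSqrt d ∨ z = -geomSqrt d := eq_geomSqrt_or_eq_neg_of_sq_eq hz2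
  rw [decompositionSubgroup_adicCompletionPrime_eq_range] at hg
  obtain ⟨τ, rfl⟩ := hg
  have hzfix : absGaloisRestrict ℚ (v.adicCompletion ℚ) τ • z = z :=
    absGaloisRestrict_smul_eq_of_mem_range ℚ v τ ⟨s, hzι.symm⟩
  rcases hz with hzpos | hzneg
  · rw [hzpos] at hzfix
    exact hzfix
  · rw [hzneg, smul_neg, neg_inj] at hzfix
    exact hzfix


/-! ### §3 No rational point of order `p` on the twist `W^{(d_K)}` under `hna`, `p` split in `K` -/

/-- **No rational point of order `p` on `W^{(d_K)}`** (`p` odd, split in the quadratic field `K`) under `hna`: along the sign-equivariant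
`W^{(d_K)}[p] ≃ W[p]` (tree `exists_signEquiv_of_twist`) a `Γ_ℚ`-fixed point of `W^{(d_K)}[p]` becomes `Q₁ ∈ W[p]` with `σQ₁ = ±Q₁` (sign of
`σ` on `√d_K`); `ℤQ₁` is a rational line, FIXED POINTWISE by `D_{𝔓₀}` (§2: `D_{𝔓₀}` fixes `√d_K`) — forbidden by `hna`.  (Door-c4 g7's
`GoodMember.addOrderOf_ne_twist` with the uniqueness of the line replaced by `hna`.) [cite: SilvermanAEC2009, X.5 Cor. 5.4] [cite: Mazur1977, Ch. III §5, p. 157] -/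
theorem addOrderOf_ne_twist_of_hna {W : WeierstrassCurve ℚ} [W.IsElliptic] {p : ℕ} [hp : Fact p.Prime] (hp2 : p ≠ 2)
    (hna : ∀ (v : HeightOneSpectrum (𝓞 ℚ)), ((p : ℕ) : 𝓞 ℚ) ∈ v.asIdeal →
      ∀ (Φ : AddSubgroup (geomTorsion W (p : ℤ))), IsRationalLine W p Φ →
      ∀ 𝔓 ∈ v.primesAbove,
        (¬ ∀ g ∈ 𝔓.decompositionSubgroup (absoluteGaloisGroup ℚ), ∀ P ∈ Φ, g • P = P) ∧
          (¬ ∀ g ∈ 𝔓.decompositionSubgroup (absoluteGaloisGroup ℚ),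
            ∀ P : geomTorsion W (p : ℤ), g • P - P ∈ Φ))
    (K : Type) [Field K] [NumberField K] (h2K : Module.finrank ℚ K = 2)
    (hsplit : ((Ideal.span {(p : ℤ)}).primesOver (𝓞 K)).ncard = 2)
    (R : (W.quadraticTwist ((NumberField.discr K : ℤ) : ℚ)).toAffine.Point) : addOrderOf R ≠ p := by
  haveI : NeZero (p : ℚ) := ⟨Nat.cast_ne_zero.mpr hp.out.ne_zero⟩
  intro hR
  have hd0 : (NumberField.discr K : ℤ) ≠ 0 := NumberField.discr_ne_zero K
  obtain ⟨P₁, -, hP₁0, hP₁fix⟩ := exists_geomTorsion_of_addOrderOf_eq (W.quadraticTwist ((NumberField.discr K : ℤ) : ℚ)) hR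
  have hd0' : ((NumberField.discr K : ℤ) : ℚ) ≠ 0 := by exact_mod_cast hd0
  obtain ⟨e, hepos, heneg⟩ := exists_signEquiv_of_twist (W := W) (Wd := W.quadraticTwist ((NumberField.discr K : ℤ) : ℚ))
    (p := p) hd0' 1 (one_smul _ _)
  set Q₁ : geomTorsion W (p : ℤ) := e P₁ with hQ₁
  have hQ₁0 : Q₁ ≠ 0 := fun h ↦ hP₁0 (e.injective (by rw [← hQ₁, h, map_zero]))
  have hsign : ∀ σ : absoluteGaloisGroup ℚ,
      σ • Q₁ = if σ • geomSqrt ((NumberField.discr K : ℤ) : ℚ) = geomSqrt ((NumberField.discr K : ℤ) : ℚ) then Q₁ else -Q₁ := by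
    intro σ
    by_cases hs : σ • geomSqrt ((NumberField.discr K : ℤ) : ℚ) = geomSqrt ((NumberField.discr K : ℤ) : ℚ)
    · rw [if_pos hs, hQ₁, ← hepos σ hs P₁, hP₁fix]
    · rw [if_neg hs, hQ₁]
      have h := heneg σ hs P₁
      rw [hP₁fix] at h
      have h' := congrArg Neg.neg h
      rw [neg_neg] at h'
      exact h'.symm
  have hord : addOrderOf Q₁ = p := addOrderOf_eq_of_ne_zero W p hQ₁0
  have hline : IsRationalLine W p (AddSubgroup.zmultiples Q₁) := by
    refine ⟨by rw [Nat.card_zmultiples, hord], fun σ Q hQ ↦ ?_⟩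
    obtain ⟨m, rfl⟩ := AddSubgroup.mem_zmultiples_iff.mp hQ
    rw [smul_comm σ m Q₁, hsign σ]
    split_ifs
    · exact AddSubgroup.zsmul_mem _ (AddSubgroup.mem_zmultiples Q₁) m
    · rw [smul_neg]
      exact AddSubgroup.neg_mem _ (AddSubgroup.zsmul_mem _ (AddSubgroup.mem_zmultiples Q₁) m)
  -- `D_{𝔓₀}` fixes `√d_K` (§2), hence `ℤQ₁` pointwise
  obtain ⟨v, hpv⟩ := Literature.NumberTheory.NumberFields.RingOfIntegers.exists_heightOneSpectrum_natCast_mem ℚ hp.out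
  refine (hna v hpv _ hline _ (adicCompletionPrime_mem_primesAbove ℚ v)).1 fun g hg Q hQ ↦ ?_
  obtain ⟨m, rfl⟩ := AddSubgroup.mem_zmultiples_iff.mp hQ
  rw [smul_comm g m Q₁, hsign g, if_pos (smul_geomSqrt_discr_eq_of_mem_decompositionSubgroup K h2K hp2 hsplit hpv hg)]

/-! ### §4 `W(K)[p] = 0` under `hna` for `p` split in the quadratic field `K` -/

/-- **`W(K)[p] = 0`** for a quadratic field `K` in which the odd prime `p` SPLITS, under `hna`: the odd-part quadratic descent
`#W(K)[p^∞] = #W(ℚ)[p^∞]·#W^{(d_K)}(ℚ)[p^∞]` (tree `card_primaryComponent_point_baseChange_quadratic_of_odd'`) and the two no-`p`-torsion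
statements `KYBranchThreeLattice.addOrderOf_ne_of_hna`, `addOrderOf_ne_twist_of_hna` (door-c4 g7's `GoodMember.forall_baseChange_nsmul_eq_zero`
pattern).  This is Keller–Yin's standing hypothesis "`H⁰(K, ρ̄_{f̃} ⊗ ε) = 0`", AUTOMATIC on the non-anomalous cell.
[cite: SilvermanAEC2009, X.5 Cor. 5.4 and Exercise 10.16] [cite: KellerYin2024b, §3.1 (hypothesis E(K)[p] = 0)] -/
theorem forall_baseChange_nsmul_eq_zero_of_hna {W : WeierstrassCurve ℚ} [W.IsElliptic] {p : ℕ} [hp : Fact p.Prime] (hp2 : p ≠ 2)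
    (hna : ∀ (v : HeightOneSpectrum (𝓞 ℚ)), ((p : ℕ) : 𝓞 ℚ) ∈ v.asIdeal →
      ∀ (Φ : AddSubgroup (geomTorsion W (p : ℤ))), IsRationalLine W p Φ →
      ∀ 𝔓 ∈ v.primesAbove,
        (¬ ∀ g ∈ 𝔓.decompositionSubgroup (absoluteGaloisGroup ℚ), ∀ P ∈ Φ, g • P = P) ∧
          (¬ ∀ g ∈ 𝔓.decompositionSubgroup (absoluteGaloisGroup ℚ),
            ∀ P : geomTorsion W (p : ℤ), g • P - P ∈ Φ))
    {K : Type} [Field K] [NumberField K] (h2K : Module.finrank ℚ K = 2)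
    (hsplit : ((Ideal.span {(p : ℤ)}).primesOver (𝓞 K)).ncard = 2)
    (Q : (W.baseChange K).toAffine.Point) (hQ : p • Q = 0) : Q = 0 := by
  have hpd : ¬ (p : ℤ) ∣ NumberField.discr K := not_dvd_discr_of_ncard_primesOver_eq_two hp.out h2K hsplit
  -- `K = ℚ(θ')`, `θ'² = d_K`
  obtain ⟨θ, c, hθ, hc⟩ := Quadratic.exists_sq_eq_algebraMap (F := ℚ) (K := K) h2K
  obtain ⟨q, hq, hd⟩ := NumberField.exists_discr_eq_mul_sq h2K hθ hc
  have hθ' : algebraMap ℚ K q * θ ∉ Set.range (algebraMap ℚ K) := by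
    rintro ⟨r, hr⟩
    apply hθ
    refine ⟨r / q, ?_⟩
    rw [map_div₀, hr, mul_div_cancel_left₀ _ ((map_ne_zero (algebraMap ℚ K)).mpr hq)]
  have hc' : (algebraMap ℚ K q * θ) ^ 2 = algebraMap ℚ K (NumberField.discr K : ℚ) := by
    rw [mul_pow, hc, ← map_pow, ← map_mul, hd, mul_comm]
  have hd0 : NumberField.discr K ≠ 0 := fun h ↦ hpd (by rw [h]; exact dvd_zero _)
  -- the odd-part quadratic descent, with the trivial models
  have hcard := card_primaryComponent_point_baseChange_quadratic_of_odd' W h2K hθ' hc'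
    (Wd := W.quadraticTwist (NumberField.discr K : ℚ)) ⟨1, one_smul _ _⟩
    (W' := W.baseChange K) ⟨1, one_smul _ _⟩ p hp2
  have h1 : Nat.card (AddCommGroup.primaryComponent W.toAffine.Point p) = 1 := by
    rw [primaryComponent_eq_bot_of_forall_addOrderOf_ne (KYBranchThreeLattice.addOrderOf_ne_of_hna hna), AddSubgroup.card_bot]
  have h2 : Nat.card
      (AddCommGroup.primaryComponent (W.quadraticTwist (NumberField.discr K : ℚ)).toAffine.Point p) = 1 := by
    rw [primaryComponent_eq_bot_of_forall_addOrderOf_ne (addOrderOf_ne_twist_of_hna hp2 hna K h2K hsplit), AddSubgroup.card_bot]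
  have key1 : ∀ inst : DecidableEq ℚ, Nat.card (@AddCommGroup.primaryComponent W.toAffine.Point
      (@Affine.Point.instAddCommGroup ℚ _ W.toAffine inst) p) = 1 := by
    intro inst
    obtain rfl : inst = instDecidableEqRat := Subsingleton.elim _ _
    exact h1
  have key2 : ∀ inst : DecidableEq ℚ, Nat.card (@AddCommGroup.primaryComponent
      (W.quadraticTwist (NumberField.discr K : ℚ)).toAffine.Point
      (@Affine.Point.instAddCommGroup ℚ _ (W.quadraticTwist (NumberField.discr K : ℚ)).toAffine inst) p) = 1 := by
    intro inst
    obtain rfl : inst = instDecidableEqRat := Subsingleton.elim _ _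
    exact h2
  have hone : Nat.card (AddCommGroup.primaryComponent (W.baseChange K).toAffine.Point p) = 1 := by
    rw [hcard, key1, key2]
  have hbot : AddCommGroup.primaryComponent (W.baseChange K).toAffine.Point p = ⊥ :=
    AddSubgroup.card_eq_one.mp hone
  have hQmem : Q ∈ AddCommGroup.primaryComponent (W.baseChange K).toAffine.Point p :=
    (AddCommGroup.mem_primaryComponent).mpr ⟨1, by rw [pow_one]; exact hQ⟩
  rw [hbot, AddSubgroup.mem_bot] at hQmem
  exact hQmem


/-! ### §5 The per-datum (G-ord, `e = 2`) door at `p = 3` with NO per-curve hypothesis beyond the cell predicates -/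

/-- **The (G-ord, `e = 2`) LOWER socket AT `p = 3`, off the `d_K = −3` sliver, non-anomalous twists, per Heegner datum — for EVERY globally
minimal curve of the cell** (Keller–Yin's per-curve hypotheses both DISCHARGED: the lattice normalisation by `KYBranchThreeLattice` §1, and
`W(K)[3] = 0` by §4, the Heegner prime `3 ∣ N_W` being split in `K`): ⟸ Kolyvagin ∧ modularity ∧ Hsieh 2014 Thm. A ∧ Liu–Zhang–Zhang 2018 ∧
Castella–Hsieh signed ∧ [DIV.dvd] (PREPRINT) ∧ [AN3] (PUB-composed, audit pending) ∧ [BR3] (PUBLISHED) ∧ eleven published facts ∧ the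
comparison data `hAUX` (existence).  `AdditiveIMCLowerBDPOnTreeLeAt 3 κ 𝔭 γ ι_𝔭 (v_3 c) P`.  CONDITIONAL on the displayed named statements;
nothing asserted about BSD. [claim: KellerYin2024PotOrd, status: under-review]
[cite: KellerYin2024b, Thm. 3.3.6, Prop. 3.4.4, Thm. 3.5.1 (arXiv:2410.23241 pp. 19–20) (preprint; the Kolyvagin clause a hypothesis)]
[cite: CastellaGrossiLeeSkinner2022, Thms. 1.2.2, 2.1.2, 2.2.2, Prop. 14] [cite: CastellaHsieh2018, §3.3, Def. 3.7, Prop. 3.8]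
[cite: Hsieh2014, Thm. A p. 712 (Doc. Math. 19)] [cite: LiuZhangZhang2018, Thm 1.5.1 and Thm 1.5.3 (Duke Math. J. 167 pp. 748–749)] -/
theorem additiveIMCLowerBDPOnTree_subGordTwo_three_offSliver
    (hKo : ∀ (N : ℕ) [NeZero N] (W : WeierstrassCurve ℚ) (K : Type) [Field K] [NumberField K],
      Literature.NumberTheory.EllipticCurves.kolyvagin N W K)
    (hPar : nonempty_modularParametrizationData)
    (hA : Hsieh2014.thmA_exists_isHsiehLFunction_unrPeriod_anyLevel)
    (hL : LiuZhangZhang2018.thm151_thm153_modularCurve_heegnerVector_additive)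
    (hCHσ : castellaHsieh2018_exists_isBranchBDPLFunction_signed)
    (hDVD : thm336_dvd_branch_OPEN) (hAN : thm351_anacong_branch_three) (hBR : thm122_charLambda_pair_three)
    (hprop125 : prop125_characterGrSelmerDual_torsion_muZero_dim) (hfact : prop14_residualCharacterSelmer_finite)
    (hlift : cor126_residualCharacter_globalLift) (hlocal : cor126_residualCharacter_localSurjective)
    (h411 : prop411_selmer_isAlmostDivisible) (h263 : prop263_sur_of_crk) (h41 : prop41_globalEulerPoincareCorank)
    (h42 : prop42_localEulerPoincareCorank) (h5A : sec5A_localH2_subsingleton_of_LOC1)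
    (h32 : prop32_cohomology_isCofinitelyGenerated) :
    ∀ (W : WeierstrassCurve ℚ) [W.IsElliptic] [W.IsGloballyMinimal],
      W.analyticRank = 1 → ClassX3 W 3 → SubGordTwo W 3 →
      (∀ (V : WeierstrassCurve ℚ) [V.IsElliptic] [V.IsGloballyMinimal] (C : VariableChange ℚ),
        GoodOrd V 3 → C • V.quadraticTwist ((-1 : ℚ) ^ (3 / 2) * (3 : ℕ)) = W → ¬ (3 : ℤ) ∣ V.frobeniusTrace 3 - 1) →
      ∀ (N : ℕ) [NeZero N] (K : Type) [Field K] [NumberField K]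
        (Dt : ModularParametrizationData W N) (H : HeegnerDatum N (NumberField.discr K)) (ι : K →+* ℂ)
        (P : (W.baseChange K).toAffine.Point),
        W.analyticRank = 1 → Additive.N10.Locus W 3 → W.conductorNorm ℤ = N → IsImaginaryQuadratic K →
        Odd (NumberField.discr K) → ¬ 3 ∣ Units.torsionOrder K → SatisfiesHeegnerHypothesis N K →
        (W.quadraticTwist (NumberField.discr K : ℚ)).entireLFunction 1 ≠ 0 →
        WeierstrassCurve.Affine.Point.map ι.toRatAlgHom P = heegnerPointComplex Dt H →
        ¬ IsOfFinAddOrder P → NumberField.discr K ≠ -3 →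
        ∀ (κ : ZpExtension K 3), κ.IsAnticyclotomic →
          ∀ (γ : Field.absoluteGaloisGroup K) [Fact (κ.IsTopGenerator γ)]
            (𝔭 : HeightOneSpectrum (𝓞 K)) (h𝔭 : ((3 : ℕ) : 𝓞 K) ∈ 𝔭.asIdeal)
            (he : 𝔭.asIdeal.ramificationIdx (𝓞 ℚ) = 1) (hf : 𝔭.asIdeal.inertiaDeg (𝓞 ℚ) = 1),
            (∀ (𝔮 : HeightOneSpectrum (𝓞 K)), ((3 : ℕ) : 𝓞 K) ∈ 𝔮.asIdeal → 𝔭 ≠ 𝔮 →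
              ∀ (ι' : PadicAlgCl 3 ≃+* ℂ), BranchInducesPrime 3 ι' 𝔮 →
                ∃ (θsub θquot θ₀ : FramedGaloisRep K (padicCoeffIntegers (∅ : Set (PadicAlgCl 3))) 1)
                  (θ₀K : HeckeCharacter K) (Cbar : Finset (HeightOneSpectrum (𝓞 K)))
                  (ΩK₀ : ℂ) (Ωp₀ : (unrIntegers 3)ˣ) (Lφ : UnrSeries 3),
                  IsResidualPairOver (W.baseChange K) 3 θsub θquot ∧ (θ₀ = θsub ∨ θ₀ = θquot) ∧
                    IsHeckeCharOf ι' θ₀ θ₀K ∧ θ₀K.IsUnramifiedAt 𝔮 ∧ θ₀K.IsUnramifiedAt 𝔭 ∧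
                    (∀ u ∈ Cbar, ¬ θ₀K.IsUnramifiedAt u) ∧ ΩK₀ ≠ 0 ∧
                    IsKatzLFunction ι' 𝔮 𝔭 Cbar κ γ θ₀K ΩK₀ ((Ωp₀ : unrIntegers 3) : ℂ_[3]) Lφ) →
            AdditiveIMCLowerBDPOnTreeLeAt 3 κ 𝔭 γ (embAt K 3 𝔭 h𝔭 he hf) (padicValNat 3 Dt.c.natAbs) P := by
  intro W _ _ hr hX hS hna N _ K _ _ Dt H ι P hr' hloc hN hK hodd hunit hHe hL1 hP hnt hdK κ hκ γ _ 𝔭 h𝔭 he hf hAUX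
  -- `3 ∣ N` (additive reduction), so `3` splits in the Heegner field `K`
  have haddv : Addv W 3 := hloc.2.1
  have h9N : 3 ^ 2 ∣ N := by
    by_contra h
    rw [← hN] at h
    rcases hasGoodReductionAtPrime_or_hasMultiplicativeReductionAtPrime_of_not_sq_dvd_conductorNorm (V := W) h with hg | hm
    · exact haddv.1 hg
    · exact haddv.2 hm
  have hsplit : ((Ideal.span {((3 : ℕ) : ℤ)}).primesOver (𝓞 K)).ncard = 2 :=
    hHe 3 Nat.prime_three (dvd_trans (dvd_pow_self 3 two_ne_zero) h9N)
  -- `W(K)[3] = 0` (§4) from the non-anomalous clause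
  have htf : ∀ Q : (W.baseChange K).toAffine.Point, 3 • Q = 0 → Q = 0 := fun Q hQ ↦
    forall_baseChange_nsmul_eq_zero_of_hna (p := 3) (by norm_num)
      (hna_isRationalLine_of_subGordTwo_of_forall_twist W (by norm_num) hX hS hna) hK.1 hsplit Q hQ
  exact additiveIMCLowerBDPOnTree_subGordTwo_three_offSliver_of_torsionFree hKo hPar hA hL hCHσ hDVD hAN hBR hprop125 hfact hlift
    hlocal h411 h263 h41 h42 h5A h32 W hr hX hS hna N K Dt H ι P hr' hloc hN hK hodd hunit hHe hL1 hP hnt hdK htf κ hκ γ 𝔭 h𝔭 he hf hAUX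

end Summit.BirchSwinnertonDyer.BirchSwinnertonDyer.Theorems.SchneiderFreeAdditiveX3.KYBranchThreeTorsion

end
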